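import Literature.NumberTheory.EllipticCurves.BSDSelmerPConverseHeegnerIndexZeroProofs
import Literature.NumberTheory.EllipticCurves.IwasawaSelmerProofs
import Literature.NumberTheory.EllipticCurves.BSDHeegnerPoints
import HarnessLib

/-!
# Specialisation of the `Λ`-adic Heegner class to the base layer: a Heegner generator of infinite order

Sibling proof file (theorems only, no named fact, D-0014/D-0026) in the story of the named fact
`Literature.NumberTheory.EllipticCurves.yanZhu_analyticRank_eq_one_of_selmerCorank_eq_one`
(X. Yan, X. Zhu, arXiv:2412.20078 = J. Algebra (2026), Cor. 1.4 = Thm. 4.15), continuing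
`Literature.NumberTheory.EllipticCurves.BSDSelmerPConverseHeegnerIndexZeroProofs`. That file ran the
Iwasawa-theoretic core of Yan–Zhu's descent sentence (proof of Thm. 4.15, §4.6: "by applying descent
arguments to (the rational part of) Theorem 4.12 (2) and using Gross-Zagier formula, we have
`corank_{ℤ_p} Sel_{p^∞}(E/K) = 1` implies `ord_{s=1} L(E/K, s) = 1`") on the tree's anticyclotomic
objects of `Literature.NumberTheory.EllipticCurves.HeegnerModuleIndex` up to the statement
"`p^m κ_∞ ∉ (γ - 1) S` for every `m`" for a generator `κ_∞` of the Heegner module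
`ℋ_∞ = Λ κ_∞ ⊆ S = 𝔖_p(K_∞)` (`pow_smul_heegnerGenerator_notMem_TSubmodule`). The present file
proves the next step of the printed argument, the SPECIALISATION TO THE BASE LAYER `K_0 = K`
(Howard 2004, §1: "part (c) of the theorem, together with the control theorem, gives the inequality
`rank_{ℤ_p} S_p(E/K) ≤ 1 + 2 · ord_J(𝐋)`"; Perrin-Riou 1987, §3.4 Prop. 10: "S'il existe un entier `n`
tel que `e_{cp^n}` est d'ordre infini, le `Λ`-module `ℋ_∞` est libre de rang `1`; il est nul
sinon"; Wan 2021, proof of Thm. 3.17: "the image `κ₁` of `κ₁^{Hg}` is not torsion", whence the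
Heegner point is non-torsion and Gross–Zagier applies), again on the tree's own objects and with
no new `def … : Prop`:

* **Layer `0` kills `J = (γ - 1)`** (`conjPi_layerSubgroup_zero`, `proj_zero_X_smul`,
  `proj_zero_eq_zero_of_mem_TSubmodule`): on `H¹(Gal(K̄/K_0), E[p^k]) = H¹(K, E[p^k])`
  (`κ.layerSubgroup 0 = Γ_K`) conjugation by `γ ∈ Γ_K` is the identity (inner automorphisms act
  trivially, tree theorem `conjH1_of_mem_holds`), so the base projection `pr_0 = D.proj 0 : S →
  S_p(E/K)` of a `Λ`-adic Selmer datum kills `T S = (γ - 1) S` (`LambdaAdicSelmerData.proj_X`) and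
  is `Λ`-semilinear through the augmentation `Λ → ℤ_p`, `f ↦ f(0)`:
  `pr_0 (f • s) = f(0) · pr_0 s` (`proj_zero_smul`).
* **Kummer classes of torsion points are torsion** (`WeierstrassCurve.nsmul_kummerClassOver_eq_zero`):
  if `n • (m • Q) = 0` then `n • δ(m • Q) = 0` in `H¹(H, E[m])` — the cocycle `n (σQ - Q)` is the
  coboundary of the `m`-torsion point `n Q` (Silverman, *AEC*, VIII.§2).
* Hence (`nsmul_eq_zero_of_mem_heegnerModuleLayer`,
  `proj_zero_natCast_smul_eq_zero_of_mem_heegnerModule`): if every generator of the Heegner family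
  visible at layer `k` is killed by `n`, so is the finite-level Heegner module `ℋ̄_k`; and if `n`
  kills `y_K` and `z_0`, then `pr_0 (n • x) = 0` for EVERY `x ∈ ℋ_∞` (span induction through
  `proj_zero_smul`).
* **Main theorem** (`exists_mem_generators_zero_not_isOfFinAddOrder`): under the hypotheses of
  `pow_smul_heegnerGenerator_notMem_TSubmodule` (Howard's Thm. B and Thm. 3.3.7 as hypotheses under
  `HowardHypotheses`, the rational Heegner point main conjecture `hMC` in the direction opposite to
  Howard's (c), and `rank_{ℤ_p} 𝒳/J𝒳 ≤ 1`, `hctl`) together with the BASE-LAYER CONTROL of the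
  compact Selmer module, `hctl₀` — the kernel of `S/JS → S_p(E/K)` is torsion (Perrin-Riou 1987,
  §2.2, proof of Lemme 5, p. 417: "L'homomorphisme `(𝔖_p(D_∞))_{Γ_n} → S_p(D_n)` a un noyau et un
  conoyau finis et d'ordre bornés"; here only: every `s` with `pr_0 s = 0` has `n • s ∈ JS` for
  some `n ≥ 1`) — ONE OF THE TWO HEEGNER GENERATORS VISIBLE OVER `K`, `y_K = Norm_{K[1]/K} P[1]` or
  `z_0 = Norm_{K[p]/K} P[p]`, HAS INFINITE ORDER in `E(K̄)`. (Otherwise a common annihilator `n`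
  of `y_K, z_0` gives `pr_0 (n κ_∞) = 0`, so `n' n κ_∞ ∈ JS`; writing `n' n = p^a u` with `p ∤ u`,
  `u` is a unit of `Λ = ℤ_p⟦T⟧`, so `p^a κ_∞ ∈ JS`, contradicting the index-zero theorem.)
* **Corollaries**: with the distribution relation between the two conductor-`≤ p` Heegner points
  in the weak form "`z_0 - a • y_K` is torsion for some `a ∈ ℤ`" (`hdist`; Perrin-Riou 1987, §3.3
  Lemme 1 and Prop. 3 — `tr e_{cp} = a_p e_c` type relations — equivalently Howard 2004, §2.7 /
  Gross 1991, Prop. 3.7; not restated here as a fact) the basic Heegner point `y_K` itself has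
  infinite order (`heegnerFamily_y_not_isOfFinAddOrder`), and so has the `K`-rational point it
  descends to (`exists_point_eq_y_not_isOfFinAddOrder`). This is the input "`y_K` is non-torsion"
  of Gross–Zagier–Kolyvagin over `K` (tree fact `analyticRankEK_eq_one_iff_heegner_nonTorsion`),
  the last clause of the printed sentence.
* **Assembly of the `K`-level sentence on Howard's locus**
  (`analyticRankEK_eq_one_of_heegner_specialization`): adding Gross–Zagier–Kolyvagin over `K`
  (tree fact `analyticRankEK_eq_one_iff_heegner_nonTorsion W N K`, as a hypothesis) and the CM
  identification of the family's base point with the tree's Heegner point of `IsHeegnerPoint`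
  (`hbridge`, inline: the Galois-transversal norm `Norm_{K[1]/K} P[1]` of `IsHeegnerNormPoint` is the
  class-group trace `heegnerPointComplex` — Gross 1984/1991 §3, Shimura reciprocity; not restated as
  a fact), the conclusion is literally `analyticRankEK W K = 1`, i.e. `ord_{s=1} L(E/K, s) = 1`. The
  hypotheses of this theorem are thus the complete list of printed inputs of Yan–Zhu's sentence that
  the tree does not yet prove: Howard's Thm. B and Thm. 3.3.7, the rational Heegner point main
  conjecture, the two control statements, the distribution relation, the CM bridge, Gross–Zagier.

Scope caveat (as in the sibling file): `HowardHypotheses` carry `p ∤ h_K` and `d_K ∉ {-3, -4}`,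
narrower than Yan–Zhu's §4.5 setting; nothing is asserted here — the file adds no `def … : Prop`.

## References

* [YanZhu2024MainConjNonCM] X. Yan, X. Zhu, arXiv:2412.20078 = J. Algebra (2026): Thm. 4.15 and its
  proof (§4.6, chunk 12 of the held text), Thm. 4.12 (2) (§4.5, chunk 11).
* [Howard2004HeegnerKolyvagin] B. Howard, Compositio Math. 140 (2004) (held: `paper:arxiv-1202.6340`):
  §1 Thm. B and eq. (2) (chunks 3–4), Thm. 3.3.7.
* [PerrinRiou1987BSMF] B. Perrin-Riou, Bull. SMF 115 (1987) (held: `paper:doi-10-24033-bsmf-2085`):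
  §2.2, proof of Lemme 5, p. 417 (base-layer control of `𝔖_p(D_∞)`); §3.3 Lemme 1, Prop. 3;
  §3.4 Prop. 10.
* [Wan2021HeegnerPointKolyvaginSystem] X. Wan, Acta Math. Sin. (Engl. Ser.) 37 (2021): Thm. 3.17
  (proof).
* [SilvermanAEC2009] J. H. Silverman, *The Arithmetic of Elliptic Curves*, VIII.§2 (Kummer pairing).
* [SerreLocalFields1979] J.-P. Serre, *Local Fields*, VII.§5 Prop. 3 (inner automorphisms act
  trivially on cohomology).
-/

noncomputable section

open scoped Classical

universe u

/-! ## Part 1. Kummer classes of torsion points are torsion -/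

namespace WeierstrassCurve

open Literature.NumberTheory.EllipticCurves

variable {K : Type u} [Field K] (V : WeierstrassCurve K)

/-- **The Kummer class of a torsion point is torsion**: for `Q ∈ E(K̄)` with `m • Q` fixed by `H`
and `n • (m • Q) = 0`, the class `n • δ(m • Q) = n • [σ ↦ σQ - Q] ∈ H¹(H, E[m])` vanishes — its
cocycle `σ ↦ n (σ Q - Q) = σ (n Q) - n Q` is the coboundary of the `m`-torsion point `n Q`
(`oneCocycleClass_eq_zero_iff`). Silverman, *AEC*, VIII.§2 (the Kummer map `E(K)/mE(K) ↪ H¹(K, E[m])`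
is a homomorphism). [cite: SilvermanAEC2009, VIII.§2] -/
theorem nsmul_kummerClassOver_eq_zero (H : Subgroup (Field.absoluteGaloisGroup K)) (m : ℤ)
    (Q : geomPoints V) (hQ : ∀ σ ∈ H, σ • (m • Q) = m • Q) {n : ℕ} (hn : n • (m • Q) = 0) :
    n • V.kummerClassOver H m Q hQ = 0 := by
  unfold kummerClassOver
  have h := Literature.NumberTheory.GaloisRepresentations.oneCocycleClass_smul
    (discreteTopRep H (geomTorsion V m)) (n : ℤ) (V.kummerCocycleOver H m Q hQ)
  conv at h => rhs; rw [Nat.cast_smul_eq_nsmul]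
  rw [← h, Literature.NumberTheory.GaloisRepresentations.oneCocycleClass_eq_zero_iff]
  have hnQ : (n : ℤ) • Q ∈ geomTorsion V m := by
    rw [mem_geomTorsion_iff, smul_smul, mul_comm, ← smul_smul, natCast_zsmul, hn]
  refine ⟨⟨(n : ℤ) • Q, hnQ⟩, fun σ ↦ Subtype.ext ?_⟩
  change (n : ℤ) • ((σ : Field.absoluteGaloisGroup K) • Q - Q) =
    (σ : Field.absoluteGaloisGroup K) • ((n : ℤ) • Q) - (n : ℤ) • Q
  rw [smul_zsmul_geomPoints, zsmul_sub]

/-! ## Part 2. The base layer `K_0 = K`: conjugation is trivial, `pr_0` kills `(γ - 1) S` -/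

section LayerZero

variable [NumberField K] {p : ℕ} [Fact p.Prime] {κ : ZpExtension K p}
  {γ : Field.absoluteGaloisGroup K}

omit [NumberField K] in
/-- **Conjugation acts trivially on `∏_k H¹(K, E[p^k])`**: `κ.layerSubgroup 0 = Γ_K`
(`ZpExtension.layerSubgroup_zero`), and for `σ ∈ H` the conjugation `conj_σ` of `H¹(H, M)` is the
identity (inner automorphisms; tree theorem `conjH1_of_mem_holds`, Serre, *Local Fields*, VII.§5
Prop. 3), componentwise in `conjPi`. [cite: SerreLocalFields1979, VII.§5 Prop. 3] -/
theorem conjPi_layerSubgroup_zero (σ : Field.absoluteGaloisGroup K)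
    (x : Π k : ℕ, V.torsionH1Over ((p : ℤ) ^ k) (κ.layerSubgroup 0)) :
    V.conjPi p (κ.layerSubgroup 0) σ x = x := by
  have hσ : σ ∈ κ.layerSubgroup 0 := by
    rw [ZpExtension.layerSubgroup_zero]; trivial
  funext k
  simp only [conjPi, AddMonoidHom.pi_apply, AddMonoidHom.coe_comp, Function.comp_apply,
    Pi.evalAddMonoidHom_apply]
  rw [Literature.NumberTheory.EllipticCurves.conjH1_of_mem_holds (κ.layerSubgroup 0)
    (geomTorsion V ((p : ℤ) ^ k)) hσ, AddMonoidHom.id_apply]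

namespace LambdaAdicSelmerData

variable (D : V.LambdaAdicSelmerData κ γ)

/-- **`pr_0 (T • s) = 0`**: `T` acts as `conj_γ - 1` (`proj_X`) and `conj_γ = id` over `K_0 = K`
(`conjPi_layerSubgroup_zero`). Perrin-Riou 1987, §0 p. 402 (the `Λ`-structure of `𝔖_p`);
Howard 2004, §1 ("`X/(γ - 1)X`", the passage to the base layer through the augmentation ideal `J`).
[cite: PerrinRiou1987BSMF, §0 p. 402] [cite: Howard2004HeegnerKolyvagin, §1 eq. (2)] -/
theorem proj_zero_X_smul (s : D.S) :
    D.proj 0 ((PowerSeries.X : IwasawaAlgebra p) • s) = 0 := by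
  rw [D.proj_X, conjPi_layerSubgroup_zero, sub_self]

/-- **`pr_0` kills `JS = (γ - 1) S`** (`TSubmodule`). [cite: Howard2004HeegnerKolyvagin, §1 eq. (2)] -/
theorem proj_zero_eq_zero_of_mem_TSubmodule {s : D.S} (hs : s ∈ IwasawaAlgebra.TSubmodule p D.S) :
    D.proj 0 s = 0 := by
  obtain ⟨y, rfl⟩ := (IwasawaAlgebra.mem_TSubmodule_iff p D.S s).mp hs
  exact D.proj_zero_X_smul V y

/-- **`pr_0` is `Λ`-semilinear through the augmentation**: `pr_0 (f • s) = f(0) · pr_0 s`, where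
`f(0) ∈ ℤ_p` acts on `∏_k H¹(K, E[p^k])` through `ℤ_p → ℤ/p^k` (`padicPi`). Split
`f = X · g + C f(0)` (`PowerSeries.eq_X_mul_shift_add_const`); the first term dies under `pr_0`
(`proj_zero_X_smul`), the second is `proj_C`. [cite: PerrinRiou1987BSMF, §0 p. 402] -/
theorem proj_zero_smul (f : IwasawaAlgebra p) (s : D.S) :
    D.proj 0 (f • s) =
      V.padicPi p (κ.layerSubgroup 0) (PowerSeries.constantCoeff f) (D.proj 0 s) := by
  conv_lhs => rw [PowerSeries.eq_X_mul_shift_add_const f]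
  rw [add_smul, map_add, mul_smul, D.proj_zero_X_smul V, zero_add, D.proj_C]

/-- `pr_0` commutes with natural multiples cast into `Λ`: `pr_0 ((n : Λ) • s) = n • pr_0 s`.
[folklore] -/
theorem proj_zero_natCast_smul (n : ℕ) (s : D.S) :
    D.proj 0 ((n : IwasawaAlgebra p) • s) = n • D.proj 0 s := by
  rw [Nat.cast_smul_eq_nsmul, map_nsmul]

end LambdaAdicSelmerData

end LayerZero

end WeierstrassCurve

/-! ## Part 3. Torsion Heegner generators give a torsion base projection of `ℋ_∞` -/

namespace Literature.NumberTheory.EllipticCurves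

open WeierstrassCurve IwasawaAlgebra

variable {N : ℕ} [NeZero N] {W : WeierstrassCurve ℚ} [W.IsGloballyMinimal] {K : Type u} [Field K]
  [NumberField K] {p : ℕ} [Fact p.Prime] {κ : ZpExtension K p} {γ : Field.absoluteGaloisGroup K}
  {jbar : AlgebraicClosure K →+* ℂ}

omit [W.IsGloballyMinimal] in
/-- `y_K` is a generator of the family visible at every layer. [folklore] -/
theorem HeegnerFamily.y_mem_generators (F : HeegnerFamily N W K κ jbar) (k : ℕ) :
    F.y ∈ F.generators k :=
  Set.mem_union_left _ (Set.mem_singleton _)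

omit [W.IsGloballyMinimal] in
/-- `z_j` is a generator of the family visible at every layer `k ≥ j`. [folklore] -/
theorem HeegnerFamily.z_mem_generators (F : HeegnerFamily N W K κ jbar) {j k : ℕ} (h : j ≤ k) :
    F.z j ∈ F.generators k :=
  Set.mem_union_right _ ⟨j, h, rfl⟩

omit [W.IsGloballyMinimal] in
/-- The generators visible at layer `0` are exactly `y_K` and `z_0`. [folklore] -/
theorem HeegnerFamily.mem_generators_zero_iff (F : HeegnerFamily N W K κ jbar)
    (w : geomPoints (W.baseChange K)) : w ∈ F.generators 0 ↔ w = F.y ∨ w = F.z 0 := by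
  constructor
  · rintro (hw | ⟨j, hj, rfl⟩)
    · exact Or.inl (Set.mem_singleton_iff.mp hw)
    · obtain rfl : j = 0 := Nat.le_zero.mp hj
      exact Or.inr rfl
  · rintro (rfl | rfl)
    · exact F.y_mem_generators 0
    · exact F.z_mem_generators le_rfl

omit [W.IsGloballyMinimal] in
/-- **A common annihilator of the generators kills the finite-level Heegner module**: if
`n • w = 0` for every generator `w` visible at layer `k` (`y_K`, `z_0, …, z_k`), then `n • v = 0`
for every `v ∈ ℋ̄_k` — the generating classes `c · conj_{γ^i} δ(w)` are images under additive maps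
(`padicPi`, `conjPi`) of families of Kummer classes `δ_{K_k}(w) ∈ H¹(K_k, E[p^m])`, each killed by
`n` (`nsmul_kummerClassOver_eq_zero`, roots `Q` of `p^m Q = w` existing in characteristic `0`,
`zsmul_geomPoints_surjective_of_charZero`), and the elements killed by `n` form a subgroup
(closure induction). Howard 2004, §3.3 (`H_k ⊆ E(K_k) ⊗ ℤ_p ↪ S_p(E/K_k)` through the Kummer map).
[cite: Howard2004HeegnerKolyvagin, §3.3 (H_k, before Thm. 3.3.7)] -/
theorem nsmul_eq_zero_of_mem_heegnerModuleLayer (F : HeegnerFamily N W K κ jbar) {k n : ℕ}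
    (hn : ∀ w ∈ F.generators k, n • w = 0)
    {v : Π m : ℕ, (W.baseChange K).torsionH1Over ((p : ℤ) ^ m) (κ.layerSubgroup k)}
    (hv : v ∈ heegnerModuleLayer γ F k) : n • v = 0 := by
  induction hv using AddSubgroup.closure_induction with
  | mem v hv =>
    obtain ⟨c, i, w, hw, d, hd, rfl⟩ := hv
    have hd0 : n • d = 0 := by
      funext m
      have hpm : ((p : ℤ) ^ m) ≠ 0 :=
        pow_ne_zero _ (Int.natCast_ne_zero.mpr (Fact.out : p.Prime).ne_zero)
      obtain ⟨Q, hQ⟩ := (W.baseChange K).zsmul_geomPoints_surjective_of_charZero hpm w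
      replace hQ : ((p : ℤ) ^ m) • Q = w := hQ
      rw [Pi.smul_apply, Pi.zero_apply, hd m Q hQ]
      exact (W.baseChange K).nsmul_kummerClassOver_eq_zero _ _ Q _ (by rw [hQ]; exact hn w hw)
    rw [← map_nsmul, ← map_nsmul, hd0, map_zero, map_zero]
  | zero => exact smul_zero _
  | add x y _ _ hx hy => rw [smul_add, hx, hy, add_zero]
  | neg x _ hx => rw [smul_neg, hx, neg_zero]

omit [W.IsGloballyMinimal] in
/-- **If `n` kills `y_K` and `z_0`, then `pr_0 (n • x) = 0` for every `x ∈ ℋ_∞`**: for the spanning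
elements `s` of `ℋ_∞` (all of whose projections lie in the `ℋ̄_k`) this is
`nsmul_eq_zero_of_mem_heegnerModuleLayer` at `k = 0`; it passes to `Λ`-multiples because `pr_0` is
semilinear through the augmentation (`proj_zero_smul`) and to sums trivially (span induction).
Perrin-Riou 1987, §3.4 (`ℋ_∞ = lim← ℋ_n`, `ℋ_0 ∋` the image); Howard 2004, §3.3.
[cite: PerrinRiou1987BSMF, §3.4] [cite: Howard2004HeegnerKolyvagin, §3.3] -/
theorem proj_zero_natCast_smul_eq_zero_of_mem_heegnerModule
    (D : (W.baseChange K).LambdaAdicSelmerData κ γ) (F : HeegnerFamily N W K κ jbar) {n : ℕ}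
    (hn : ∀ w ∈ F.generators 0, n • w = 0) {x : D.S} (hx : x ∈ heegnerModule D F) :
    D.proj 0 ((n : IwasawaAlgebra p) • x) = 0 := by
  induction hx using Submodule.span_induction with
  | mem s hs =>
    rw [D.proj_zero_natCast_smul]
    exact nsmul_eq_zero_of_mem_heegnerModuleLayer F hn (hs 0)
  | zero => rw [smul_zero, map_zero]
  | add x y _ _ hx hy => rw [smul_add, map_add, hx, hy, add_zero]
  | smul f x _ hx =>
    rw [smul_smul, mul_comm, ← smul_smul, D.proj_zero_smul, hx, map_zero]

/-! ## Part 4. `p`-power bookkeeping in `Λ = ℤ_p⟦T⟧` -/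

/-- A natural number prime to `p` is a unit of `Λ = ℤ_p⟦T⟧` (it is a unit of `ℤ_p`:
`‖u‖_p = 1`). Washington, §13.2; Bourbaki, AC VII. [folklore] -/
theorem isUnit_natCast_iwasawaAlgebra_of_not_dvd {u : ℕ} (hu : ¬ p ∣ u) :
    IsUnit (u : IwasawaAlgebra p) := by
  have hnorm : ‖((u : ℤ) : ℤ_[p])‖ = 1 := by
    refine le_antisymm (PadicInt.norm_le_one _) (not_lt.mp ?_)
    rw [PadicInt.norm_int_lt_one_iff_dvd]
    exact_mod_cast hu
  have h1 : IsUnit ((u : ℕ) : ℤ_[p]) := by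
    rw [← Int.cast_natCast]
    exact PadicInt.isUnit_iff.mpr hnorm
  have h2 := h1.map (PowerSeries.C (R := ℤ_[p]))
  rwa [map_natCast] at h2

/-- **From an arbitrary multiple to a `p`-power multiple inside a `Λ`-submodule**: if `n • s ∈ M'`
with `n ≠ 0`, write `n = p^a u` with `p ∤ u`; `u` is a unit of `Λ`, so `p^a • s ∈ M'`. [folklore] -/
theorem exists_pow_smul_mem_of_natCast_smul_mem {S : Type*} [AddCommGroup S]
    [Module (IwasawaAlgebra p) S] (M' : Submodule (IwasawaAlgebra p) S) {s : S} {n : ℕ}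
    (hn : n ≠ 0) (h : (n : IwasawaAlgebra p) • s ∈ M') :
    ∃ a : ℕ, ((p : IwasawaAlgebra p) ^ a) • s ∈ M' := by
  obtain ⟨a, u, hu, rfl⟩ :=
    Nat.exists_eq_pow_mul_and_not_dvd hn p (Fact.out : p.Prime).one_lt.ne'
  refine ⟨a, ?_⟩
  obtain ⟨U, hU⟩ := isUnit_natCast_iwasawaAlgebra_of_not_dvd (p := p) hu
  have h' := M'.smul_mem (↑U⁻¹ : IwasawaAlgebra p) h
  rwa [smul_smul, Nat.cast_mul, Nat.cast_pow, ← hU, mul_comm ((p : IwasawaAlgebra p) ^ a),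
    Units.inv_mul_cancel_left] at h'

/-! ## Part 5. The specialisation theorem: a Heegner generator of infinite order -/

/-- **One of `y_K`, `z_0` has infinite order in `E(K̄)`** — the specialisation of the `J`-indivisible
`Λ`-adic Heegner class to the base layer (Howard 2004, §1: "part (c) of the theorem, together with
the control theorem, gives the inequality `rank_{ℤ_p} S_p(E/K) ≤ 1 + 2 · ord_J(𝐋)`"; Perrin-Riou
1987, §3.4 Prop. 10: "S'il existe un entier `n` tel que `e_{cp^n}` est d'ordre infini, le
`Λ`-module `ℋ_∞` est libre de rang `1`; il est nul sinon"; Wan 2021, proof of Thm. 3.17: "the image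
`κ₁` of `κ₁^{Hg}` is not torsion"). Hypotheses: those of
`pow_smul_heegnerGenerator_notMem_TSubmodule` (Howard's Thm. B `hB` and Thm. 3.3.7 `hH` under
`HowardHypotheses`; the rational Heegner point main conjecture `hMC` in the direction opposite to
Howard's (c), Yan–Zhu Thm. 4.12 (2); `rank_{ℤ_p} 𝒳/J𝒳 ≤ 1`, `hctl`, Mazur's control theorem with
corank one), and the base-layer control of the compact Selmer module, `hctl₀`: the kernel of
`S/JS → S_p(E/K)`, `s ↦ pr_0 s`, is torsion (Perrin-Riou 1987, §2.2, proof of Lemme 5, p. 417: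
"L'homomorphisme `(𝔖_p(D_∞))_{Γ_n} → S_p(D_n)` a un noyau et un conoyau finis et d'ordre bornés";
only "every `s` with `pr_0 s = 0` has `n • s ∈ JS` for some `n ≥ 1`" is used). Proof: if `y_K` and
`z_0` both had finite order, a common annihilator `n` would give `pr_0 (n κ_∞) = 0`
(`proj_zero_natCast_smul_eq_zero_of_mem_heegnerModule`), so `n' n κ_∞ ∈ JS` by `hctl₀`, so
`p^a κ_∞ ∈ JS` (`exists_pow_smul_mem_of_natCast_smul_mem`), contradicting
`pow_smul_heegnerGenerator_notMem_TSubmodule`.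
[cite: YanZhu2024MainConjNonCM, Thm. 4.15 (proof, §4.6) with Thm. 4.12 (2)]
[cite: Howard2004HeegnerKolyvagin, §1 eq. (2), Thm. B and Thm. 3.3.7]
[cite: PerrinRiou1987BSMF, §2.2 (proof of Lemme 5, p. 417) and §3.4 Prop. 10]
[cite: Wan2021HeegnerPointKolyvaginSystem, Thm. 3.17 (proof)] -/
theorem exists_mem_generators_zero_not_isOfFinAddOrder
    (hB : Howard2004_thmB N W K p κ γ jbar) (hH : Howard2004_heegnerModule_free N W K p κ γ jbar)
    (hyp : HowardHypotheses N W K p κ γ)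
    (D : (W.baseChange K).LambdaAdicSelmerData κ γ) (F : HeegnerFamily N W K κ jbar)
    (X : (W.baseChange K).SelmerDualData κ γ)
    {c : ℤ_[p]} (hc : c ≠ 0)
    (hMC : Ideal.span {(PowerSeries.C c : IwasawaAlgebra p)} *
        Module.charIdeal (IwasawaAlgebra p) (Submodule.torsion (IwasawaAlgebra p) X.X) ≤
      heegnerCharIdeal D F ^ 2)
    (hctl : coinvariantsRank p X.X ≤ 1)
    (hctl₀ : ∀ s : D.S, D.proj 0 s = 0 →
      ∃ n : ℕ, n ≠ 0 ∧ (n : IwasawaAlgebra p) • s ∈ TSubmodule p D.S) :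
    ∃ w ∈ F.generators 0, ¬ IsOfFinAddOrder w := by
  by_contra hall
  push Not at hall
  -- a common annihilator of `y_K` and `z_0`
  have hy : IsOfFinAddOrder F.y := hall _ (F.y_mem_generators 0)
  have hz : IsOfFinAddOrder (F.z 0) := hall _ (F.z_mem_generators le_rfl)
  set n : ℕ := addOrderOf F.y * addOrderOf (F.z 0) with hn_def
  have hn0 : n ≠ 0 := mul_ne_zero hy.addOrderOf_pos.ne' hz.addOrderOf_pos.ne'
  have hkill : ∀ w ∈ F.generators 0, n • w = 0 := by
    intro w hw
    rcases (F.mem_generators_zero_iff w).mp hw with rfl | rfl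
    · rw [hn_def, mul_comm, mul_smul, addOrderOf_nsmul_eq_zero, smul_zero]
    · rw [hn_def, mul_smul, addOrderOf_nsmul_eq_zero, smul_zero]
  -- the generator `κ_∞` of `ℋ_∞` and its base projection
  obtain ⟨g, -, hg⟩ := exists_heegnerModule_eq_span_singleton hH hyp D F
  have hgmem : g ∈ heegnerModule D F := by
    rw [hg]; exact Submodule.mem_span_singleton_self g
  have hproj : D.proj 0 ((n : IwasawaAlgebra p) • g) = 0 :=
    proj_zero_natCast_smul_eq_zero_of_mem_heegnerModule D F hkill hgmem
  obtain ⟨n', hn', hmem⟩ := hctl₀ _ hproj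
  rw [smul_smul, ← Nat.cast_mul] at hmem
  obtain ⟨a, ha⟩ := exists_pow_smul_mem_of_natCast_smul_mem (TSubmodule p D.S)
    (mul_ne_zero hn' hn0) hmem
  exact pow_smul_heegnerGenerator_notMem_TSubmodule hB hH hyp D F X hc hMC hctl hg a ha

/-- **`y_K` has infinite order**, given in addition the distribution relation between the two
Heegner points of conductor `≤ p` in the weak form "`z_0 - a • y_K` is torsion for some `a ∈ ℤ`"
(`hdist`; Perrin-Riou 1987, §3.3, Lemme 1 and Prop. 3: the trace relations
`tr_{H_{cp}/H_c} e_{cp} = a_p e_c - …` between Heegner points of conductors `cp^n`; Gross 1991,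
Prop. 3.7; Howard 2004, §2.7 — for `z_0 = Norm_{K[p]/K} P[p]` and `y_K = Norm_{K[1]/K} P[1]` they
give `u_K z_0 ∈ ℤ y_K` up to torsion; not vendored here): then `z_0` torsion-or-not is decided by
`y_K`, and `exists_mem_generators_zero_not_isOfFinAddOrder` leaves only `y_K`.
[cite: YanZhu2024MainConjNonCM, Thm. 4.15 (proof, §4.6)]
[cite: PerrinRiou1987BSMF, §3.3 Lemme 1, Prop. 3 and §3.4 Prop. 10]
[cite: Howard2004HeegnerKolyvagin, §1 eq. (2) and §2.7] -/
theorem heegnerFamily_y_not_isOfFinAddOrder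
    (hB : Howard2004_thmB N W K p κ γ jbar) (hH : Howard2004_heegnerModule_free N W K p κ γ jbar)
    (hyp : HowardHypotheses N W K p κ γ)
    (D : (W.baseChange K).LambdaAdicSelmerData κ γ) (F : HeegnerFamily N W K κ jbar)
    (X : (W.baseChange K).SelmerDualData κ γ)
    {c : ℤ_[p]} (hc : c ≠ 0)
    (hMC : Ideal.span {(PowerSeries.C c : IwasawaAlgebra p)} *
        Module.charIdeal (IwasawaAlgebra p) (Submodule.torsion (IwasawaAlgebra p) X.X) ≤
      heegnerCharIdeal D F ^ 2)
    (hctl : coinvariantsRank p X.X ≤ 1)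
    (hctl₀ : ∀ s : D.S, D.proj 0 s = 0 →
      ∃ n : ℕ, n ≠ 0 ∧ (n : IwasawaAlgebra p) • s ∈ TSubmodule p D.S)
    (hdist : ∃ a : ℤ, IsOfFinAddOrder (F.z 0 - a • F.y)) :
    ¬ IsOfFinAddOrder F.y := by
  intro hy
  obtain ⟨w, hw, hwinf⟩ :=
    exists_mem_generators_zero_not_isOfFinAddOrder hB hH hyp D F X hc hMC hctl hctl₀
  obtain ⟨a, ha⟩ := hdist
  apply hwinf
  rcases (F.mem_generators_zero_iff w).mp hw with rfl | rfl
  · exact hy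
  · have h := ha.add (hy.zsmul (i := a))
    rwa [sub_add_cancel] at h

/-- **The `K`-rational Heegner point has infinite order**: `y_K` descends to a point
`P ∈ E(K)` (`HeegnerFamily.exists_toGeomPoints_eq_y`), and `E(K) ↪ E(K̄)` is an injective
homomorphism, so `P` has infinite order with `y_K` (`heegnerFamily_y_not_isOfFinAddOrder`). This is
the input "`y_K` is non-torsion" of Gross–Zagier–Kolyvagin over `K` (tree fact
`analyticRankEK_eq_one_iff_heegner_nonTorsion`), the last clause of Yan–Zhu's sentence ("and
using Gross-Zagier formula, … `ord_{s=1} L(E/K, s) = 1`").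
[cite: YanZhu2024MainConjNonCM, Thm. 4.15 (proof, §4.6)]
[cite: Howard2004HeegnerKolyvagin, §1 eq. (2) and §2.7] -/
theorem exists_point_eq_y_not_isOfFinAddOrder
    (hB : Howard2004_thmB N W K p κ γ jbar) (hH : Howard2004_heegnerModule_free N W K p κ γ jbar)
    (hyp : HowardHypotheses N W K p κ γ)
    (D : (W.baseChange K).LambdaAdicSelmerData κ γ) (F : HeegnerFamily N W K κ jbar)
    (X : (W.baseChange K).SelmerDualData κ γ)
    {c : ℤ_[p]} (hc : c ≠ 0)
    (hMC : Ideal.span {(PowerSeries.C c : IwasawaAlgebra p)} *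
        Module.charIdeal (IwasawaAlgebra p) (Submodule.torsion (IwasawaAlgebra p) X.X) ≤
      heegnerCharIdeal D F ^ 2)
    (hctl : coinvariantsRank p X.X ≤ 1)
    (hctl₀ : ∀ s : D.S, D.proj 0 s = 0 →
      ∃ n : ℕ, n ≠ 0 ∧ (n : IwasawaAlgebra p) • s ∈ TSubmodule p D.S)
    (hdist : ∃ a : ℤ, IsOfFinAddOrder (F.z 0 - a • F.y)) :
    ∃ P : (W.baseChange K).toAffine.Point,
      toGeomPoints (W.baseChange K) P = F.y ∧ ¬ IsOfFinAddOrder P := by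
  obtain ⟨P, hP⟩ := F.exists_toGeomPoints_eq_y
  refine ⟨P, hP, fun hfin ↦ ?_⟩
  have h := (toGeomPoints (W.baseChange K)).isOfFinAddOrder hfin
  rw [hP] at h
  exact heegnerFamily_y_not_isOfFinAddOrder hB hH hyp D F X hc hMC hctl hctl₀ hdist h

/-! ## Part 6. Assembly: the `K`-level sentence on Howard's locus -/

/-- **`corank`-one descent over `K`, assembled on Howard's locus: `ord_{s=1} L(E/K, s) = 1`.**
Yan–Zhu's sentence (proof of Thm. 4.15, §4.6: "by applying descent arguments to (the rational part
of) Theorem 4.12 (2) and using Gross-Zagier formula, we have `corank_{ℤ_p} Sel_{p^∞}(E/K) = 1`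
implies `ord_{s=1} L(E/K, s) = 1`") with EVERY input the tree does not yet prove made explicit:
Howard's Thm. B (`hB`) and Thm. 3.3.7 (`hH`) under `HowardHypotheses` (`hyp`); the rational Heegner
point main conjecture in the direction opposite to Howard's (c) (`hc`, `hMC`; Yan–Zhu Thm. 4.12 (2));
Mazur's control theorem with the corank-one hypothesis, `rank_{ℤ_p} 𝒳/J𝒳 ≤ 1` (`hctl`; Howard 2004,
§1); the base-layer control of the compact Selmer module (`hctl₀`; Perrin-Riou 1987, §2.2); the
distribution relation between the Heegner points of conductor `1` and `p` (`hdist`; Perrin-Riou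
1987, §3.3); the CM identification of the family's base point `y_K = Norm_{K[1]/K} P[1]` with a
Heegner point of the tree's `IsHeegnerPoint` (`hbridge`; Gross 1991, §3 with Shimura reciprocity);
and Gross–Zagier–Kolyvagin over `K` (`hGZK`, tree fact `analyticRankEK_eq_one_iff_heegner_nonTorsion`).
Then `y_K` has infinite order (`exists_point_eq_y_not_isOfFinAddOrder`) and Gross–Zagier gives
`analyticRankEK W K = 1`. Nothing new is asserted: all inputs are hypotheses.
[cite: YanZhu2024MainConjNonCM, Thm. 4.15 (proof, §4.6) with Thm. 4.12 (2)]
[cite: Howard2004HeegnerKolyvagin, §1 eq. (2), Thm. B and Thm. 3.3.7]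
[cite: PerrinRiou1987BSMF, §2.2 (proof of Lemme 5, p. 417), §3.3 and §3.4 Prop. 10]
[cite: GrossZagier1986, Thm. I.6.3 with V.§2] -/
theorem analyticRankEK_eq_one_of_heegner_specialization
    (hB : Howard2004_thmB N W K p κ γ jbar) (hH : Howard2004_heegnerModule_free N W K p κ γ jbar)
    (hyp : HowardHypotheses N W K p κ γ)
    (D : (W.baseChange K).LambdaAdicSelmerData κ γ) (F : HeegnerFamily N W K κ jbar)
    (X : (W.baseChange K).SelmerDualData κ γ)
    {c : ℤ_[p]} (hc : c ≠ 0)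
    (hMC : Ideal.span {(PowerSeries.C c : IwasawaAlgebra p)} *
        Module.charIdeal (IwasawaAlgebra p) (Submodule.torsion (IwasawaAlgebra p) X.X) ≤
      heegnerCharIdeal D F ^ 2)
    (hctl : coinvariantsRank p X.X ≤ 1)
    (hctl₀ : ∀ s : D.S, D.proj 0 s = 0 →
      ∃ n : ℕ, n ≠ 0 ∧ (n : IwasawaAlgebra p) • s ∈ TSubmodule p D.S)
    (hdist : ∃ a : ℤ, IsOfFinAddOrder (F.z 0 - a • F.y))
    (hbridge : ∀ P : (W.baseChange K).toAffine.Point,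
      toGeomPoints (W.baseChange K) P = F.y → IsHeegnerPoint N W K P)
    (hGZK : analyticRankEK_eq_one_iff_heegner_nonTorsion W N K)
    (hN : W.conductorNorm ℤ = N) :
    analyticRankEK W K = 1 := by
  haveI := hyp.isElliptic
  obtain ⟨P, hP, hinf⟩ :=
    exists_point_eq_y_not_isOfFinAddOrder hB hH hyp D F X hc hMC hctl hctl₀ hdist
  exact (hGZK hyp.isImaginaryQuadratic hN hyp.heegner (hbridge P hP)).mpr hinf

end Literature.NumberTheory.EllipticCurves

end
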